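import Summits.Ventures.PercRepro.RLSClassSumsT1
import Summits.Ventures.PercRepro.RLSGenericT0Sums

/-!
# C-025 at q = 3: P₂ at `t = 1` under `R₃⁺` — the witness sums with `|K| = p − 1 = n + 3` (night-3, gen 3)

At type `t = 1` the plane `G` sees an independent set `K ⊆ E ∖ G` of size `p − 1 = n + 3` (not `n + 4`); the per-`B′`
accounting of the (L3)/(L2) loss cases needs the same sums as `RLSZeroSums` with outside count `n + 3`:
`t1z1Sum n = Σ_{i<n} C(n+3, i+1)/C(i+5, 3)`, `t1z2Sum n = Σ_{i<n} C(n+3, i+1)/C(i+6, 3)` (the pure shares of a `4`- / `5`-set),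
`t1lost4Sum n = Σ_{j<n−2} C(n, j)/C(j+7, 3)`, `t1lost5Sum n = Σ_{j<n−2} C(n, j)/C(j+8, 3)` (the witnesses through a fixed
triple), `t1lostSum n = Σ_{j<n−2} C(n, j)`, `t1l2aSum n = Σ_{i<n} C(n, i+1) + 3·C(n, i)`.  Closed forms via the ratio
identities of `RLSClassSumsT1` (`U1.ratio_j`, general in the top argument) and the level sums of `RLSClosedForms`; polynomial
forms `…P` for the certificates of `RLSZeroWorldT1`.  No `decide`.
-/

open PercRepro.NightThree.CF PercRepro.NightThree.U0

namespace PercRepro.NightThree.W1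

open Finset

/-- `Σ_{y<2} C(N, y) = 1 + N`. -/
theorem sum_range_two (N : ℕ) : (∑ y ∈ range 2, (N.choose y : ℚ)) = 1 + N := by
  simp [sum_range_succ]

/-- The pure share of a `4`-set at `t = 1`: `Σ_{i<n} C(n+3, i+1)/C(i+5, 3)`. -/
def t1z1Sum (n : ℕ) : ℚ := ∑ i ∈ range n, ((n + 3).choose (i + 1) : ℚ) / ((i + 5).choose 3 : ℚ)

/-- The pure share of a `5`-set at `t = 1`: `Σ_{i<n} C(n+3, i+1)/C(i+6, 3)`. -/
def t1z2Sum (n : ℕ) : ℚ := ∑ i ∈ range n, ((n + 3).choose (i + 1) : ℚ) / ((i + 6).choose 3 : ℚ)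

/-- `Σ_{i<n} C(n+3, i+1)/C(i+4, 3)` (auxiliary). -/
def t1z0Sum (n : ℕ) : ℚ := ∑ i ∈ range n, ((n + 3).choose (i + 1) : ℚ) / ((i + 4).choose 3 : ℚ)

/-- The witnesses through a fixed triple, `4`-set share: `Σ_{j<n−2} C(n, j)/C(j+7, 3)`. -/
def t1lost4Sum (n : ℕ) : ℚ := ∑ j ∈ range (n - 2), (n.choose j : ℚ) / ((j + 7).choose 3 : ℚ)

/-- The witnesses through a fixed triple, `5`-set share: `Σ_{j<n−2} C(n, j)/C(j+8, 3)`. -/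
def t1lost5Sum (n : ℕ) : ℚ := ∑ j ∈ range (n - 2), (n.choose j : ℚ) / ((j + 8).choose 3 : ℚ)

/-- The witnesses through a fixed triple, counted: `Σ_{j<n−2} C(n, j)`. -/
def t1lostSum (n : ℕ) : ℚ := ∑ j ∈ range (n - 2), (n.choose j : ℚ)

/-- The (L2) lower bound of a `≥ 6`-set at `t = 1`: `Σ_{i<n} C(n, i+1) + 3·C(n, i)`. -/
def t1l2aSum (n : ℕ) : ℚ := ∑ i ∈ range n, ((n.choose (i + 1) : ℚ) + 3 * (n.choose i : ℚ))

/-! ## Level sums over `range n` with top `n + 6`, `n + 7`, `n + 8` (upper tail of `3` terms) -/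

/-- `Σ_{i<n} C(n+6, i+4)` in closed form. -/
theorem sum_level_four' (n : ℕ) :
    (∑ i ∈ range n, ((n + 6).choose (i + 4) : ℚ)) = 2 ^ (n + 6) - (1 + ((n : ℚ) + 6) + ((n + 6).choose 2 : ℚ) + ((n + 6).choose 3 : ℚ)) - (1 + ((n : ℚ) + 6) + ((n + 6).choose 2 : ℚ)) := by
  rw [sum_choose_shift (n + 6) 4 n, sum_choose_Ico (n + 6) 4 (4 + n) (by omega) (by omega)]
  have ht := sum_choose_tail (n + 6) 3 (by omega)
  rw [show n + 6 + 1 - 3 = 4 + n by omega] at ht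
  rw [ht, sum_range_four, U0.sum_range_three]; push_cast; ring

/-- `Σ_{i<n} C(n+7, i+5)` in closed form. -/
theorem sum_level_five' (n : ℕ) :
    (∑ i ∈ range n, ((n + 7).choose (i + 5) : ℚ)) = 2 ^ (n + 7) - (1 + ((n : ℚ) + 7) + ((n + 7).choose 2 : ℚ) + ((n + 7).choose 3 : ℚ) + ((n + 7).choose 4 : ℚ)) - (1 + ((n : ℚ) + 7) + ((n + 7).choose 2 : ℚ)) := by
  rw [sum_choose_shift (n + 7) 5 n, sum_choose_Ico (n + 7) 5 (5 + n) (by omega) (by omega)]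
  have ht := sum_choose_tail (n + 7) 3 (by omega)
  rw [show n + 7 + 1 - 3 = 5 + n by omega] at ht
  rw [ht, sum_range_five, U0.sum_range_three]; push_cast; ring

/-- `Σ_{i<n} C(n+8, i+6)` in closed form. -/
theorem sum_level_six' (n : ℕ) :
    (∑ i ∈ range n, ((n + 8).choose (i + 6) : ℚ)) = 2 ^ (n + 8) - (1 + ((n : ℚ) + 8) + ((n + 8).choose 2 : ℚ) + ((n + 8).choose 3 : ℚ) + ((n + 8).choose 4 : ℚ) + ((n + 8).choose 5 : ℚ)) - (1 + ((n : ℚ) + 8) + ((n + 8).choose 2 : ℚ)) := by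
  rw [sum_choose_shift (n + 8) 6 n, sum_choose_Ico (n + 8) 6 (6 + n) (by omega) (by omega)]
  have ht := sum_choose_tail (n + 8) 3 (by omega)
  rw [show n + 8 + 1 - 3 = 6 + n by omega] at ht
  rw [ht, U0.sum_range_six, U0.sum_range_three]; push_cast; ring

/-! ## Level sums over `range (n − 2)` with top `n + 3 + j` (upper tail of `2` terms), `n ≥ 2` -/

/-- `Σ_{i<n−2} C(n+3, i+4)` in closed form (`n ≥ 2`). -/
theorem level_0_0 (n : ℕ) (hn : 2 ≤ n) :
    (∑ i ∈ range (n - 2), ((n + 3).choose (i + 4) : ℚ)) = 2 ^ (n + 3) - (1 + ((n : ℚ) + 3) + ((n + 3).choose 2 : ℚ) + ((n + 3).choose 3 : ℚ)) - (1 + ((n : ℚ) + 3)) := by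
  rw [sum_choose_shift (n + 3) 4 (n - 2), sum_choose_Ico (n + 3) 4 (4 + (n - 2)) (by omega) (by omega)]
  have ht := sum_choose_tail (n + 3) 2 (by omega)
  rw [show n + 3 + 1 - 2 = 4 + (n - 2) by omega] at ht
  rw [ht, sum_range_four, sum_range_two]; push_cast; ring

/-- `Σ_{i<n−2} C(n+4, i+5)` in closed form (`n ≥ 2`). -/
theorem level_0_1 (n : ℕ) (hn : 2 ≤ n) :
    (∑ i ∈ range (n - 2), ((n + 4).choose (i + 5) : ℚ)) = 2 ^ (n + 4) - (1 + ((n : ℚ) + 4) + ((n + 4).choose 2 : ℚ) + ((n + 4).choose 3 : ℚ) + ((n + 4).choose 4 : ℚ)) - (1 + ((n : ℚ) + 4)) := by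
  rw [sum_choose_shift (n + 4) 5 (n - 2), sum_choose_Ico (n + 4) 5 (5 + (n - 2)) (by omega) (by omega)]
  have ht := sum_choose_tail (n + 4) 2 (by omega)
  rw [show n + 4 + 1 - 2 = 5 + (n - 2) by omega] at ht
  rw [ht, sum_range_five, sum_range_two]; push_cast; ring

/-- `Σ_{i<n−2} C(n+5, i+6)` in closed form (`n ≥ 2`). -/
theorem level_0_2 (n : ℕ) (hn : 2 ≤ n) :
    (∑ i ∈ range (n - 2), ((n + 5).choose (i + 6) : ℚ)) = 2 ^ (n + 5) - (1 + ((n : ℚ) + 5) + ((n + 5).choose 2 : ℚ) + ((n + 5).choose 3 : ℚ) + ((n + 5).choose 4 : ℚ) + ((n + 5).choose 5 : ℚ)) - (1 + ((n : ℚ) + 5)) := by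
  rw [sum_choose_shift (n + 5) 6 (n - 2), sum_choose_Ico (n + 5) 6 (6 + (n - 2)) (by omega) (by omega)]
  have ht := sum_choose_tail (n + 5) 2 (by omega)
  rw [show n + 5 + 1 - 2 = 6 + (n - 2) by omega] at ht
  rw [ht, U0.sum_range_six, sum_range_two]; push_cast; ring

/-- `Σ_{i<n−2} C(n+6, i+7)` in closed form (`n ≥ 2`). -/
theorem level_0_3 (n : ℕ) (hn : 2 ≤ n) :
    (∑ i ∈ range (n - 2), ((n + 6).choose (i + 7) : ℚ)) = 2 ^ (n + 6) - (1 + ((n : ℚ) + 6) + ((n + 6).choose 2 : ℚ) + ((n + 6).choose 3 : ℚ) + ((n + 6).choose 4 : ℚ) + ((n + 6).choose 5 : ℚ) + ((n + 6).choose 6 : ℚ)) - (1 + ((n : ℚ) + 6)) := by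
  rw [sum_choose_shift (n + 6) 7 (n - 2), sum_choose_Ico (n + 6) 7 (7 + (n - 2)) (by omega) (by omega)]
  have ht := sum_choose_tail (n + 6) 2 (by omega)
  rw [show n + 6 + 1 - 2 = 7 + (n - 2) by omega] at ht
  rw [ht, U1.sum_range_seven, sum_range_two]; push_cast; ring

/-- `Σ_{i<n−2} C(n+7, i+8)` in closed form (`n ≥ 2`). -/
theorem level_0_4 (n : ℕ) (hn : 2 ≤ n) :
    (∑ i ∈ range (n - 2), ((n + 7).choose (i + 8) : ℚ)) = 2 ^ (n + 7) - (1 + ((n : ℚ) + 7) + ((n + 7).choose 2 : ℚ) + ((n + 7).choose 3 : ℚ) + ((n + 7).choose 4 : ℚ) + ((n + 7).choose 5 : ℚ) + ((n + 7).choose 6 : ℚ) + ((n + 7).choose 7 : ℚ)) - (1 + ((n : ℚ) + 7)) := by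
  rw [sum_choose_shift (n + 7) 8 (n - 2), sum_choose_Ico (n + 7) 8 (8 + (n - 2)) (by omega) (by omega)]
  have ht := sum_choose_tail (n + 7) 2 (by omega)
  rw [show n + 7 + 1 - 2 = 8 + (n - 2) by omega] at ht
  rw [ht, U1.sum_range_eight, sum_range_two]; push_cast; ring

/-- `Σ_{i<n−2} C(n, i+1)/C(i+7, 3)` in closed form (`n ≥ 2`). -/
theorem texp_7_0 (n : ℕ) (hn : 2 ≤ n) :
    (∑ i ∈ range (n - 2), (n.choose (i + 1) : ℚ) / ((i + 7).choose 3 : ℚ)) = (1 : ℚ) * ((2 ^ (n + 3) - (1 + ((n : ℚ) + 3) + ((n + 3).choose 2 : ℚ) + ((n + 3).choose 3 : ℚ)) - (1 + ((n : ℚ) + 3))) / ((n + 3).choose 3 : ℚ)) + (-(9/4) : ℚ) * ((2 ^ (n + 4) - (1 + ((n : ℚ) + 4) + ((n + 4).choose 2 : ℚ) + ((n + 4).choose 3 : ℚ) + ((n + 4).choose 4 : ℚ)) - (1 + ((n : ℚ) + 4))) / ((n + 4).choose 4 : ℚ)) + (9/5 : ℚ) * ((2 ^ (n + 5) - (1 +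 ((n : ℚ) + 5) + ((n + 5).choose 2 : ℚ) + ((n + 5).choose 3 : ℚ) + ((n + 5).choose 4 : ℚ) + ((n + 5).choose 5 : ℚ)) - (1 + ((n : ℚ) + 5))) / ((n + 5).choose 5 : ℚ)) + (-(1/2) : ℚ) * ((2 ^ (n + 6) - (1 + ((n : ℚ) + 6) + ((n + 6).choose 2 : ℚ) + ((n + 6).choose 3 : ℚ) + ((n + 6).choose 4 : ℚ) + ((n + 6).choose 5 : ℚ) + ((n + 6).choose 6 : ℚ)) - (1 + ((n : ℚ) + 6))) / ((n + 6).choose 6 : ℚ)) := by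
  have hterm : ∀ i ∈ range (n - 2), (n.choose (i + 1) : ℚ) / ((i + 7).choose 3 : ℚ) = (1 : ℚ) * (((n + 3).choose (i + 4) : ℚ) / ((n + 3).choose 3 : ℚ)) + (-(9/4) : ℚ) * (((n + 4).choose (i + 5) : ℚ) / ((n + 4).choose 4 : ℚ)) + (9/5 : ℚ) * (((n + 5).choose (i + 6) : ℚ) / ((n + 5).choose 5 : ℚ)) + (-(1/2) : ℚ) * (((n + 6).choose (i + 7) : ℚ) / ((n + 6).choose 6 : ℚ)) := by
    intro i _
    rw [div_eq_mul_one_div, U1.inv_choose_7, ← U1.ratio_0 n, ← U1.ratio_1 n, ← U1.ratio_2 n, ← U1.ratio_3 n]; ring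
  rw [sum_congr rfl hterm]
  simp only [sum_add_distrib, ← mul_sum, ← sum_div]
  rw [level_0_0 n hn, level_0_1 n hn, level_0_2 n hn, level_0_3 n hn]

/-- `Σ_{i<n−2} C(n, i+1)/C(i+8, 3)` in closed form (`n ≥ 2`). -/
theorem texp_8_0 (n : ℕ) (hn : 2 ≤ n) :
    (∑ i ∈ range (n - 2), (n.choose (i + 1) : ℚ) / ((i + 8).choose 3 : ℚ)) = (1 : ℚ) * ((2 ^ (n + 3) - (1 + ((n : ℚ) + 3) + ((n + 3).choose 2 : ℚ) + ((n + 3).choose 3 : ℚ)) - (1 + ((n : ℚ) + 3))) / ((n + 3).choose 3 : ℚ)) + (-3 : ℚ) * ((2 ^ (n + 4) - (1 + ((n : ℚ) + 4) + ((n + 4).choose 2 : ℚ) + ((n + 4).choose 3 : ℚ) + ((n + 4).choose 4 : ℚ)) - (1 + ((n : ℚ) + 4))) / ((n + 4).choose 4 : ℚ)) + (18/5 : ℚ) * ((2 ^ (n + 5) - (1 + ((n : ℚ) + 5) + ((n + 5).choose 2 : ℚ) + ((n + 5).choose 3 : ℚ) + ((n + 5).choose 4 : ℚ) + ((n + 5).choose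 5 : ℚ)) - (1 + ((n : ℚ) + 5))) / ((n + 5).choose 5 : ℚ)) + (-2 : ℚ) * ((2 ^ (n + 6) - (1 + ((n : ℚ) + 6) + ((n + 6).choose 2 : ℚ) + ((n + 6).choose 3 : ℚ) + ((n + 6).choose 4 : ℚ) + ((n + 6).choose 5 : ℚ) + ((n + 6).choose 6 : ℚ)) - (1 + ((n : ℚ) + 6))) / ((n + 6).choose 6 : ℚ)) + (3/7 : ℚ) * ((2 ^ (n + 7) - (1 + ((n : ℚ) + 7) + ((n + 7).choose 2 : ℚ) + ((n + 7).choose 3 : ℚ) + ((n + 7).choose 4 : ℚ) + ((n + 7).choose 5 : ℚ) + ((n + 7).choose 6 : ℚ) + ((n + 7).choose 7 : ℚ)) - (1 + ((n : ℚ) + 7))) / ((n + 7).choose 7 : ℚ)) := by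
  have hterm : ∀ i ∈ range (n - 2), (n.choose (i + 1) : ℚ) / ((i + 8).choose 3 : ℚ) = (1 : ℚ) * (((n + 3).choose (i + 4) : ℚ) / ((n + 3).choose 3 : ℚ)) + (-3 : ℚ) * (((n + 4).choose (i + 5) : ℚ) / ((n + 4).choose 4 : ℚ)) + (18/5 : ℚ) * (((n + 5).choose (i + 6) : ℚ) / ((n + 5).choose 5 : ℚ)) + (-2 : ℚ) * (((n + 6).choose (i + 7) : ℚ) / ((n + 6).choose 6 : ℚ)) + (3/7 : ℚ) * (((n + 7).choose (i + 8) : ℚ) / ((n + 7).choose 7 : ℚ)) := by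
    intro i _
    rw [div_eq_mul_one_div, U1.inv_choose_8, ← U1.ratio_0 n, ← U1.ratio_1 n, ← U1.ratio_2 n, ← U1.ratio_3 n, ← U1.ratio_4 n]; ring
  rw [sum_congr rfl hterm]
  simp only [sum_add_distrib, ← mul_sum, ← sum_div]
  rw [level_0_0 n hn, level_0_1 n hn, level_0_2 n hn, level_0_3 n hn, level_0_4 n hn]

/-- Pascal split of `Σ_{j<n−2} C(n, j) f j`. -/
theorem pascal_split_t1 (n : ℕ) (f : ℕ → ℚ) :
    (∑ j ∈ range (n - 2), (n.choose j : ℚ) * f j) =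
      (∑ j ∈ range (n - 2), ((n + 1).choose (j + 1) : ℚ) * f j) - ∑ j ∈ range (n - 2), (n.choose (j + 1) : ℚ) * f j := by
  rw [← sum_sub_distrib]
  apply sum_congr rfl
  intro j _
  rw [Nat.choose_succ_succ']; push_cast; ring

/-- `t1lost4Sum` after the Pascal split. -/
theorem t1lost4_closed (n : ℕ) : t1lost4Sum n =
    (∑ j ∈ range (n - 2), ((n + 1).choose (j + 1) : ℚ) / ((j + 7).choose 3 : ℚ)) - ∑ j ∈ range (n - 2), (n.choose (j + 1) : ℚ) / ((j + 7).choose 3 : ℚ) := by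
  unfold t1lost4Sum
  have := pascal_split_t1 n (fun j => 1 / ((j + 7).choose 3 : ℚ))
  simp only [mul_one_div] at this
  exact this

/-- `t1lost5Sum` after the Pascal split. -/
theorem t1lost5_closed (n : ℕ) : t1lost5Sum n =
    (∑ j ∈ range (n - 2), ((n + 1).choose (j + 1) : ℚ) / ((j + 8).choose 3 : ℚ)) - ∑ j ∈ range (n - 2), (n.choose (j + 1) : ℚ) / ((j + 8).choose 3 : ℚ) := by
  unfold t1lost5Sum
  have := pascal_split_t1 n (fun j => 1 / ((j + 8).choose 3 : ℚ))
  simp only [mul_one_div] at this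
  exact this

/-- `t1lostSum n = 2^n − (1 + n + C(n,2))` (`n ≥ 2`). -/
theorem t1lost_closed (n : ℕ) (hn : 2 ≤ n) : t1lostSum n = 2 ^ n - (1 + (n : ℚ) + (n.choose 2 : ℚ)) := by
  unfold t1lostSum
  have hsplit := Finset.sum_range_add_sum_Ico (fun j => (n.choose j : ℚ)) (show n - 2 ≤ n + 1 by omega)
  have htot : (∑ j ∈ range (n + 1), (n.choose j : ℚ)) = 2 ^ n := by exact_mod_cast Nat.sum_range_choose n
  have ht := sum_choose_tail n 3 (by omega)
  rw [show n + 1 - 3 = n - 2 by omega] at ht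
  rw [htot, ht, U0.sum_range_three] at hsplit
  linarith

/-- `t1l2aSum n = (2^n − 1) + 3(2^n − 1)`. -/
theorem t1l2a_closed (n : ℕ) : t1l2aSum n = (2 ^ n - 1) + 3 * (2 ^ n - 1) := by
  unfold t1l2aSum
  rw [sum_add_distrib, ← mul_sum]
  have h1 : (∑ i ∈ range n, (n.choose (i + 1) : ℚ)) = 2 ^ n - 1 := by
    rw [sum_choose_shift n 1 n, sum_choose_Ico n 1 (1 + n) (by omega) (by omega), U0.sum_range_one,
      show 1 + n = n + 1 by omega, Finset.Ico_self, Finset.sum_empty]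
    ring
  have h0 : (∑ i ∈ range n, (n.choose i : ℚ)) = 2 ^ n - 1 := by
    have hsplit := Finset.sum_range_add_sum_Ico (fun j => (n.choose j : ℚ)) (show n ≤ n + 1 by omega)
    have htot : (∑ j ∈ range (n + 1), (n.choose j : ℚ)) = 2 ^ n := by exact_mod_cast Nat.sum_range_choose n
    have ht := sum_choose_tail n 1 (by omega)
    rw [show n + 1 - 1 = n by omega] at ht
    rw [htot, ht, U0.sum_range_one] at hsplit
    linarith
  rw [h1, h0]

/-! ## The `z` sums in closed form -/

/-- `t1z0Sum n` in closed form. -/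
theorem t1z0_closed (n : ℕ) :
    t1z0Sum n = (2 ^ (n + 6) - (1 + ((n : ℚ) + 6) + ((n + 6).choose 2 : ℚ) + ((n + 6).choose 3 : ℚ)) - (1 + ((n : ℚ) + 6) + ((n + 6).choose 2 : ℚ))) / ((n + 6).choose 3 : ℚ) := by
  unfold t1z0Sum
  rw [sum_congr rfl (fun i _ => U1.ratio_0 (n + 3) i), ← sum_div]
  simp only [show n + 3 + 3 = n + 6 by omega]
  rw [sum_level_four']

/-- `t1z1Sum n` in closed form. -/
theorem t1z1_closed (n : ℕ) :
    t1z1Sum n = t1z0Sum n - 3 / 4 * ((2 ^ (n + 7) - (1 + ((n : ℚ) + 7) + ((n + 7).choose 2 : ℚ) + ((n + 7).choose 3 : ℚ) + ((n + 7).choose 4 : ℚ)) - (1 + ((n : ℚ) + 7) + ((n + 7).choose 2 : ℚ))) / ((n + 7).choose 4 : ℚ)) := by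
  unfold t1z1Sum t1z0Sum
  have hterm : ∀ i ∈ range n, ((n + 3).choose (i + 1) : ℚ) / ((i + 5).choose 3 : ℚ) =
      ((n + 3).choose (i + 1) : ℚ) / ((i + 4).choose 3 : ℚ) - 3 / 4 * (((n + 7).choose (i + 5) : ℚ) / ((n + 7).choose 4 : ℚ)) := by
    intro i _
    rw [show n + 7 = n + 3 + 4 by omega, ← U1.ratio_1, div_eq_mul_one_div, U0.inv_choose_five]; ring
  rw [sum_congr rfl hterm, sum_sub_distrib, ← mul_sum, ← sum_div, sum_level_five']

/-- `t1z2Sum n` in closed form. -/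
theorem t1z2_closed (n : ℕ) :
    t1z2Sum n = t1z0Sum n - 3 / 2 * ((2 ^ (n + 7) - (1 + ((n : ℚ) + 7) + ((n + 7).choose 2 : ℚ) + ((n + 7).choose 3 : ℚ) + ((n + 7).choose 4 : ℚ)) - (1 + ((n : ℚ) + 7) + ((n + 7).choose 2 : ℚ))) / ((n + 7).choose 4 : ℚ))
      + 3 / 5 * ((2 ^ (n + 8) - (1 + ((n : ℚ) + 8) + ((n + 8).choose 2 : ℚ) + ((n + 8).choose 3 : ℚ) + ((n + 8).choose 4 : ℚ) + ((n + 8).choose 5 : ℚ)) - (1 + ((n : ℚ) + 8) + ((n + 8).choose 2 : ℚ))) / ((n + 8).choose 5 : ℚ)) := by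
  unfold t1z2Sum t1z0Sum
  have hterm : ∀ i ∈ range n, ((n + 3).choose (i + 1) : ℚ) / ((i + 6).choose 3 : ℚ) =
      ((n + 3).choose (i + 1) : ℚ) / ((i + 4).choose 3 : ℚ) - 3 / 2 * (((n + 7).choose (i + 5) : ℚ) / ((n + 7).choose 4 : ℚ))
        + 3 / 5 * (((n + 8).choose (i + 6) : ℚ) / ((n + 8).choose 5 : ℚ)) := by
    intro i _
    rw [show n + 7 = n + 3 + 4 by omega, show n + 8 = n + 3 + 5 by omega, ← U1.ratio_1, ← U1.ratio_2, div_eq_mul_one_div, U0.inv_choose_six]; ring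
  rw [sum_congr rfl hterm, sum_add_distrib, sum_sub_distrib, ← mul_sum, ← mul_sum, ← sum_div, ← sum_div, sum_level_five', sum_level_six']

/-! ## Polynomial forms -/

/-- `t1z0Sum` as a rational function. -/
def t1z0P (n : ℕ) : ℚ := ((64 * 2 ^ n - (1 + ((n : ℚ) + 6) + (((n : ℚ) + 6) * ((n : ℚ) + 5) / 2) + (((n : ℚ) + 6) * ((n : ℚ) + 5) * ((n : ℚ) + 4) / 6)) - (1 + ((n : ℚ) + 6) + (((n : ℚ) + 6) * ((n : ℚ) + 5) / 2))) / (((n : ℚ) + 6) * ((n : ℚ) + 5) * ((n : ℚ) + 4) / 6))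

/-- The `4`-level correction as a rational function. -/
def t1v5P (n : ℕ) : ℚ := ((128 * 2 ^ n - (1 + ((n : ℚ) + 7) + (((n : ℚ) + 7) * ((n : ℚ) + 6) / 2) + (((n : ℚ) + 7) * ((n : ℚ) + 6) * ((n : ℚ) + 5) / 6) + (((n : ℚ) + 7) * ((n : ℚ) + 6) * ((n : ℚ) + 5) * ((n : ℚ) + 4) / 24)) - (1 + ((n : ℚ) + 7) + (((n : ℚ) + 7) * ((n : ℚ) + 6) / 2))) / (((n : ℚ) + 7) * ((n : ℚ) + 6) * ((n : ℚ) + 5) * ((n : ℚ) + 4) / 24))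

/-- The `5`-level correction as a rational function. -/
def t1v6P (n : ℕ) : ℚ := ((256 * 2 ^ n - (1 + ((n : ℚ) + 8) + (((n : ℚ) + 8) * ((n : ℚ) + 7) / 2) + (((n : ℚ) + 8) * ((n : ℚ) + 7) * ((n : ℚ) + 6) / 6) + (((n : ℚ) + 8) * ((n : ℚ) + 7) * ((n : ℚ) + 6) * ((n : ℚ) + 5) / 24) + (((n : ℚ) + 8) * ((n : ℚ) + 7) * ((n : ℚ) + 6) * ((n : ℚ) + 5) * ((n : ℚ) + 4) / 120)) - (1 + ((n : ℚ) + 8) + (((n : ℚ) + 8) * ((n : ℚ) + 7) / 2))) / (((n : ℚ) + 8) * ((n : ℚ) + 7) * ((n : ℚ) + 6) * ((n : ℚ) + 5) * ((n : ℚ) + 4) / 120))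

/-- `t1z1Sum` as a rational function. -/
def t1z1P (n : ℕ) : ℚ := t1z0P n - 3 / 4 * t1v5P n

/-- `t1z2Sum` as a rational function. -/
def t1z2P (n : ℕ) : ℚ := t1z0P n - 3 / 2 * t1v5P n + 3 / 5 * t1v6P n

/-- `t1lost4Sum` as a rational function: `texp(7,1) − texp(7,0)`. -/
def t1lost4P (n : ℕ) : ℚ := ((1 : ℚ) * ((16 * 2 ^ n - (1 + ((n : ℚ) + 4) + (((n : ℚ) + 4) * ((n : ℚ) + 3) / 2) + (((n : ℚ) + 4) * ((n : ℚ) + 3) * ((n : ℚ) + 2) / 6)) - (1 + ((n : ℚ) + 4) + (((n : ℚ) + 4) * ((n : ℚ) + 3) / 2))) / (((n : ℚ) + 4) * ((n : ℚ) + 3) * ((n : ℚ) + 2) / 6)) + (-(9/4) : ℚ) * ((32 * 2 ^ n - (1 + ((n : ℚ) + 5) + (((n : ℚ) + 5) * ((n : ℚ) + 4) / 2) + (((n : ℚ) + 5) * ((n : ℚ) + 4) * ((n : ℚ) + 3) / 6) + (((n : ℚ) + 5) * ((n : ℚ) + 4) * ((n : ℚ) + 3) * ((n : ℚ) + 2)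 / 24)) - (1 + ((n : ℚ) + 5) + (((n : ℚ) + 5) * ((n : ℚ) + 4) / 2))) / (((n : ℚ) + 5) * ((n : ℚ) + 4) * ((n : ℚ) + 3) * ((n : ℚ) + 2) / 24)) + (9/5 : ℚ) * ((64 * 2 ^ n - (1 + ((n : ℚ) + 6) + (((n : ℚ) + 6) * ((n : ℚ) + 5) / 2) + (((n : ℚ) + 6) * ((n : ℚ) + 5) * ((n : ℚ) + 4) / 6) + (((n : ℚ) + 6) * ((n : ℚ) + 5) * ((n : ℚ) + 4) * ((n : ℚ) + 3) / 24) + (((n : ℚ) + 6) * ((n : ℚ) + 5) * ((n : ℚ) + 4) * ((n : ℚ) + 3) * ((n : ℚ) + 2) / 120)) - (1 + ((n : ℚ) + 6) + (((n : ℚ) + 6) * ((n : ℚ) + 5) / 2))) / (((n : ℚ) + 6) * ((n : ℚ) + 5) * ((n : ℚ) + 4) * ((n : ℚ) + 3) * ((n : ℚ) + 2) / 120)) + (-(1/2) : ℚ) * ((128 * 2 ^ n - (1 + ((n : ℚ) + 7) + (((n : ℚ) + 7) * ((n : ℚ) + 6) / 2) + (((n : ℚ) + 7) * ((n : ℚ)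 + 6) * ((n : ℚ) + 5) / 6) + (((n : ℚ) + 7) * ((n : ℚ) + 6) * ((n : ℚ) + 5) * ((n : ℚ) + 4) / 24) + (((n : ℚ) + 7) * ((n : ℚ) + 6) * ((n : ℚ) + 5) * ((n : ℚ) + 4) * ((n : ℚ) + 3) / 120) + (((n : ℚ) + 7) * ((n : ℚ) + 6) * ((n : ℚ) + 5) * ((n : ℚ) + 4) * ((n : ℚ) + 3) * ((n : ℚ) + 2) / 720)) - (1 + ((n : ℚ) + 7) + (((n : ℚ) + 7) * ((n : ℚ) + 6) / 2))) / (((n : ℚ) + 7) * ((n : ℚ) + 6) * ((n : ℚ) + 5) * ((n : ℚ) + 4) * ((n : ℚ) + 3) * ((n : ℚ) + 2) / 720))) - ((1 : ℚ) * ((8 * 2 ^ n - (1 + ((n : ℚ) + 3) + (((n : ℚ) + 3) * ((n : ℚ) + 2) / 2) + (((n : ℚ) + 3) * ((n : ℚ) + 2) * ((n : ℚ) + 1) / 6)) - (1 + ((n : ℚ) + 3))) / (((n : ℚ) + 3) * ((n : ℚ) + 2) * ((n : ℚ) + 1) / 6)) + (-(9/4) : ℚ) * ((16 * 2 ^ n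 - (1 + ((n : ℚ) + 4) + (((n : ℚ) + 4) * ((n : ℚ) + 3) / 2) + (((n : ℚ) + 4) * ((n : ℚ) + 3) * ((n : ℚ) + 2) / 6) + (((n : ℚ) + 4) * ((n : ℚ) + 3) * ((n : ℚ) + 2) * ((n : ℚ) + 1) / 24)) - (1 + ((n : ℚ) + 4))) / (((n : ℚ) + 4) * ((n : ℚ) + 3) * ((n : ℚ) + 2) * ((n : ℚ) + 1) / 24)) + (9/5 : ℚ) * ((32 * 2 ^ n - (1 + ((n : ℚ) + 5) + (((n : ℚ) + 5) * ((n : ℚ) + 4) / 2) + (((n : ℚ) + 5) * ((n : ℚ) + 4) * ((n : ℚ) + 3) / 6) + (((n : ℚ) + 5) * ((n : ℚ) + 4) * ((n : ℚ) + 3) * ((n : ℚ) + 2) / 24) + (((n : ℚ) + 5) * ((n : ℚ) + 4) * ((n : ℚ) + 3) * ((n : ℚ) + 2) * ((n : ℚ) + 1) / 120)) - (1 + ((n : ℚ) + 5))) / (((n : ℚ) + 5) * ((n : ℚ) + 4) * ((n : ℚ) + 3) * ((n : ℚ) + 2) * ((n : ℚ) + 1) / 120)) + (-(1/2) : ℚ)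 * ((64 * 2 ^ n - (1 + ((n : ℚ) + 6) + (((n : ℚ) + 6) * ((n : ℚ) + 5) / 2) + (((n : ℚ) + 6) * ((n : ℚ) + 5) * ((n : ℚ) + 4) / 6) + (((n : ℚ) + 6) * ((n : ℚ) + 5) * ((n : ℚ) + 4) * ((n : ℚ) + 3) / 24) + (((n : ℚ) + 6) * ((n : ℚ) + 5) * ((n : ℚ) + 4) * ((n : ℚ) + 3) * ((n : ℚ) + 2) / 120) + (((n : ℚ) + 6) * ((n : ℚ) + 5) * ((n : ℚ) + 4) * ((n : ℚ) + 3) * ((n : ℚ) + 2) * ((n : ℚ) + 1) / 720)) - (1 + ((n : ℚ) + 6))) / (((n : ℚ) + 6) * ((n : ℚ) + 5) * ((n : ℚ) + 4) * ((n : ℚ) + 3) * ((n : ℚ) + 2) * ((n : ℚ) + 1) / 720)))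

/-- `t1lost5Sum` as a rational function: `texp(8,1) − texp(8,0)`. -/
def t1lost5P (n : ℕ) : ℚ := ((1 : ℚ) * ((16 * 2 ^ n - (1 + ((n : ℚ) + 4) + (((n : ℚ) + 4) * ((n : ℚ) + 3) / 2) + (((n : ℚ) + 4) * ((n : ℚ) + 3) * ((n : ℚ) + 2) / 6)) - (1 + ((n : ℚ) + 4) + (((n : ℚ) + 4) * ((n : ℚ) + 3) / 2))) / (((n : ℚ) + 4) * ((n : ℚ) + 3) * ((n : ℚ) + 2) / 6)) + (-3 : ℚ) * ((32 * 2 ^ n - (1 + ((n : ℚ) + 5) + (((n : ℚ) + 5) * ((n : ℚ) + 4) / 2) + (((n : ℚ) + 5) * ((n : ℚ) + 4) * ((n : ℚ) + 3) / 6) + (((n : ℚ) + 5) * ((n : ℚ) + 4) * ((n : ℚ) + 3) * ((n : ℚ) + 2) / 24)) - (1 + ((n : ℚ) + 5) + (((n : ℚ) + 5) * ((n : ℚ) + 4) / 2))) / (((n : ℚ) + 5) * ((n : ℚ) + 4) * ((n : ℚ) + 3) * ((n : ℚ) + 2) / 24)) + (18/5 : ℚ) * ((64 * 2 ^ n - (1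 + ((n : ℚ) + 6) + (((n : ℚ) + 6) * ((n : ℚ) + 5) / 2) + (((n : ℚ) + 6) * ((n : ℚ) + 5) * ((n : ℚ) + 4) / 6) + (((n : ℚ) + 6) * ((n : ℚ) + 5) * ((n : ℚ) + 4) * ((n : ℚ) + 3) / 24) + (((n : ℚ) + 6) * ((n : ℚ) + 5) * ((n : ℚ) + 4) * ((n : ℚ) + 3) * ((n : ℚ) + 2) / 120)) - (1 + ((n : ℚ) + 6) + (((n : ℚ) + 6) * ((n : ℚ) + 5) / 2))) / (((n : ℚ) + 6) * ((n : ℚ) + 5) * ((n : ℚ) + 4) * ((n : ℚ) + 3) * ((n : ℚ) + 2) / 120)) + (-2 : ℚ) * ((128 * 2 ^ n - (1 + ((n : ℚ) + 7) + (((n : ℚ) + 7) * ((n : ℚ) + 6) / 2) + (((n : ℚ) + 7) * ((n : ℚ) + 6) * ((n : ℚ) + 5) / 6) + (((n : ℚ) + 7) * ((n : ℚ) + 6) * ((n : ℚ) + 5) * ((n : ℚ) + 4) / 24) + (((n : ℚ) + 7) * ((n : ℚ) + 6) * ((n : ℚ) + 5) * ((n : ℚ) + 4) * ((n : ℚ)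 + 3) / 120) + (((n : ℚ) + 7) * ((n : ℚ) + 6) * ((n : ℚ) + 5) * ((n : ℚ) + 4) * ((n : ℚ) + 3) * ((n : ℚ) + 2) / 720)) - (1 + ((n : ℚ) + 7) + (((n : ℚ) + 7) * ((n : ℚ) + 6) / 2))) / (((n : ℚ) + 7) * ((n : ℚ) + 6) * ((n : ℚ) + 5) * ((n : ℚ) + 4) * ((n : ℚ) + 3) * ((n : ℚ) + 2) / 720)) + (3/7 : ℚ) * ((256 * 2 ^ n - (1 + ((n : ℚ) + 8) + (((n : ℚ) + 8) * ((n : ℚ) + 7) / 2) + (((n : ℚ) + 8) * ((n : ℚ) + 7) * ((n : ℚ) + 6) / 6) + (((n : ℚ) + 8) * ((n : ℚ) + 7) * ((n : ℚ) + 6) * ((n : ℚ) + 5) / 24) + (((n : ℚ) + 8) * ((n : ℚ) + 7) * ((n : ℚ) + 6) * ((n : ℚ) + 5) * ((n : ℚ) + 4) / 120) + (((n : ℚ) + 8) * ((n : ℚ) + 7) * ((n : ℚ) + 6) * ((n : ℚ) + 5) * ((n : ℚ) + 4) * ((n : ℚ) + 3) / 720) + (((n : ℚ) + 8) * ((n :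 ℚ) + 7) * ((n : ℚ) + 6) * ((n : ℚ) + 5) * ((n : ℚ) + 4) * ((n : ℚ) + 3) * ((n : ℚ) + 2) / 5040)) - (1 + ((n : ℚ) + 8) + (((n : ℚ) + 8) * ((n : ℚ) + 7) / 2))) / (((n : ℚ) + 8) * ((n : ℚ) + 7) * ((n : ℚ) + 6) * ((n : ℚ) + 5) * ((n : ℚ) + 4) * ((n : ℚ) + 3) * ((n : ℚ) + 2) / 5040))) - ((1 : ℚ) * ((8 * 2 ^ n - (1 + ((n : ℚ) + 3) + (((n : ℚ) + 3) * ((n : ℚ) + 2) / 2) + (((n : ℚ) + 3) * ((n : ℚ) + 2) * ((n : ℚ) + 1) / 6)) - (1 + ((n : ℚ) + 3))) / (((n : ℚ) + 3) * ((n : ℚ) + 2) * ((n : ℚ) + 1) / 6)) + (-3 : ℚ) * ((16 * 2 ^ n - (1 + ((n : ℚ) + 4) + (((n : ℚ) + 4) * ((n : ℚ) + 3) / 2) + (((n : ℚ) + 4) * ((n : ℚ) + 3) * ((n : ℚ) + 2) / 6) + (((n : ℚ) + 4) * ((n : ℚ) + 3) * ((n : ℚ) + 2) * ((n : ℚ)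 + 1) / 24)) - (1 + ((n : ℚ) + 4))) / (((n : ℚ) + 4) * ((n : ℚ) + 3) * ((n : ℚ) + 2) * ((n : ℚ) + 1) / 24)) + (18/5 : ℚ) * ((32 * 2 ^ n - (1 + ((n : ℚ) + 5) + (((n : ℚ) + 5) * ((n : ℚ) + 4) / 2) + (((n : ℚ) + 5) * ((n : ℚ) + 4) * ((n : ℚ) + 3) / 6) + (((n : ℚ) + 5) * ((n : ℚ) + 4) * ((n : ℚ) + 3) * ((n : ℚ) + 2) / 24) + (((n : ℚ) + 5) * ((n : ℚ) + 4) * ((n : ℚ) + 3) * ((n : ℚ) + 2) * ((n : ℚ) + 1) / 120)) - (1 + ((n : ℚ) + 5))) / (((n : ℚ) + 5) * ((n : ℚ) + 4) * ((n : ℚ) + 3) * ((n : ℚ) + 2) * ((n : ℚ) + 1) / 120)) + (-2 : ℚ) * ((64 * 2 ^ n - (1 + ((n : ℚ) + 6) + (((n : ℚ) + 6) * ((n : ℚ) + 5) / 2) + (((n : ℚ) + 6) * ((n : ℚ) + 5) * ((n : ℚ) + 4) / 6) + (((n : ℚ) + 6) * ((n : ℚ) + 5) * ((n : ℚ) + 4)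 * ((n : ℚ) + 3) / 24) + (((n : ℚ) + 6) * ((n : ℚ) + 5) * ((n : ℚ) + 4) * ((n : ℚ) + 3) * ((n : ℚ) + 2) / 120) + (((n : ℚ) + 6) * ((n : ℚ) + 5) * ((n : ℚ) + 4) * ((n : ℚ) + 3) * ((n : ℚ) + 2) * ((n : ℚ) + 1) / 720)) - (1 + ((n : ℚ) + 6))) / (((n : ℚ) + 6) * ((n : ℚ) + 5) * ((n : ℚ) + 4) * ((n : ℚ) + 3) * ((n : ℚ) + 2) * ((n : ℚ) + 1) / 720)) + (3/7 : ℚ) * ((128 * 2 ^ n - (1 + ((n : ℚ) + 7) + (((n : ℚ) + 7) * ((n : ℚ) + 6) / 2) + (((n : ℚ) + 7) * ((n : ℚ) + 6) * ((n : ℚ) + 5) / 6) + (((n : ℚ) + 7) * ((n : ℚ) + 6) * ((n : ℚ) + 5) * ((n : ℚ) + 4) / 24) + (((n : ℚ) + 7) * ((n : ℚ) + 6) * ((n : ℚ) + 5) * ((n : ℚ) + 4) * ((n : ℚ) + 3) / 120) + (((n : ℚ) + 7) * ((n : ℚ) + 6) * ((n : ℚ) + 5) * ((n : ℚ) + 4)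 * ((n : ℚ) + 3) * ((n : ℚ) + 2) / 720) + (((n : ℚ) + 7) * ((n : ℚ) + 6) * ((n : ℚ) + 5) * ((n : ℚ) + 4) * ((n : ℚ) + 3) * ((n : ℚ) + 2) * ((n : ℚ) + 1) / 5040)) - (1 + ((n : ℚ) + 7))) / (((n : ℚ) + 7) * ((n : ℚ) + 6) * ((n : ℚ) + 5) * ((n : ℚ) + 4) * ((n : ℚ) + 3) * ((n : ℚ) + 2) * ((n : ℚ) + 1) / 5040)))

/-- `t1lostSum` as a polynomial. -/
def t1lostP (n : ℕ) : ℚ := 2 ^ n - (1 + (n : ℚ) + (n : ℚ) * ((n : ℚ) - 1) / 2)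

/-- `t1l2aSum` as a polynomial. -/
def t1l2aP (n : ℕ) : ℚ := (2 ^ n - 1) + 3 * (2 ^ n - 1)

/-- `t1z0Sum = t1z0P`. -/
theorem t1z0_eq_P (n : ℕ) : t1z0Sum n = t1z0P n := by
  rw [t1z0_closed]; unfold t1z0P
  simp only [U0.choose_three_cast, U0.choose_two_cast]
  push_cast
  simp only [pow_add]
  ring_nf

/-- `t1z1Sum = t1z1P`. -/
theorem t1z1_eq_P (n : ℕ) : t1z1Sum n = t1z1P n := by
  rw [t1z1_closed, t1z0_eq_P]; unfold t1z1P t1v5P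
  simp only [U0.choose_four_cast, U0.choose_three_cast, U0.choose_two_cast]
  push_cast
  simp only [pow_add]
  ring_nf

/-- `t1z2Sum = t1z2P`. -/
theorem t1z2_eq_P (n : ℕ) : t1z2Sum n = t1z2P n := by
  rw [t1z2_closed, t1z0_eq_P]; unfold t1z2P t1v5P t1v6P
  simp only [U0.choose_five_cast, U0.choose_four_cast, U0.choose_three_cast, U0.choose_two_cast]
  push_cast
  simp only [pow_add]
  ring_nf

/-- `t1lost4Sum = t1lost4P` (`n ≥ 2`). -/
theorem t1lost4_eq_P (n : ℕ) (hn : 2 ≤ n) : t1lost4Sum n = t1lost4P n := by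
  rw [t1lost4_closed, U1.texp_7_1 n hn, texp_7_0 n hn]; unfold t1lost4P
  simp only [U1.choose_six_cast, U0.choose_five_cast, U0.choose_four_cast, U0.choose_three_cast, U0.choose_two_cast]
  push_cast
  simp only [pow_add]
  ring_nf

/-- `t1lost5Sum = t1lost5P` (`n ≥ 2`). -/
theorem t1lost5_eq_P (n : ℕ) (hn : 2 ≤ n) : t1lost5Sum n = t1lost5P n := by
  rw [t1lost5_closed, U1.texp_8_1 n hn, texp_8_0 n hn]; unfold t1lost5P
  simp only [U1.choose_seven_cast, U1.choose_six_cast, U0.choose_five_cast, U0.choose_four_cast, U0.choose_three_cast, U0.choose_two_cast]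
  push_cast
  simp only [pow_add]
  ring_nf

/-- `t1lostSum = t1lostP` (`n ≥ 2`). -/
theorem t1lost_eq_P (n : ℕ) (hn : 2 ≤ n) : t1lostSum n = t1lostP n := by
  rw [t1lost_closed n hn]; unfold t1lostP
  rw [U0.choose_two_cast]

/-- `t1l2aSum = t1l2aP`. -/
theorem t1l2a_eq_P (n : ℕ) : t1l2aSum n = t1l2aP n := by
  rw [t1l2a_closed]; rfl

end PercRepro.NightThree.W1
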